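import Summits.HodgeConjecture.HodgeConjecture.Theses.LinearSystemTorelli
import Literature.AlgebraicGeometry.HodgeTheory.SupportedClassesRationalProofs
import Literature.AlgebraicGeometry.HodgeTheory.SupportedClassesHodgeConiveau
import Literature.AlgebraicGeometry.HodgeTheory.HodgeFiltrationModelsReductionProofs
import Literature.AlgebraicGeometry.HodgeTheory.HardLefschetzThreefold
import Literature.AlgebraicGeometry.HodgeTheory.TopDegreeClasses
import Literature.AlgebraicGeometry.Motives.ComplexPointsOrientation
import Literature.AlgebraicGeometry.HodgeTheory.VanishingCohomologyNontrivialProofs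
import Literature.AlgebraicGeometry.HodgeTheory.SupportedClassesHodgeConiveauProofs
import Literature.AlgebraicGeometry.HodgeTheory.ComplexConjugationHolds
import Literature.NumberTheory.Transcendental.DeRhamTheoremMultiplicative

/-!
# Route LinearSystemTorelli — crux `MiddleDivisorSupportFourfold` (stmt-HodgeConjecture-2409), line `Sketch`: stub `PairingSplit`

Helper file for the crux item stmt-HodgeConjecture-2409 (route `LinearSystemTorelli`), serving the
registered stub `stub_pairingSplit : PairingSplit` of the line skeleton
`Cruxes/MiddleDivisorSupportFourfold/Lines/Sketch.lean` (de Cataldo–Migliorini, arXiv:0711.1307 §4,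
Fact 4.1 with `n = 2`; Brosnan–Fang–Nie–Pearlstein 2009, §6, the sentence after (6.1): "the Hodge
conjecture for `Y` is equivalent to the assertion that the perpendicular subspace
`(Alg^k Y)^⊥ ⊂ Hdg^{dim Y − k} Y` is zero"). The stub says: on a smooth projective complex fourfold
`X`, IF every non-zero rational `(2,2)`-class `c` has a partner `a ∈ Alg² = supportedClasses X 4 2`
with `c ∪ a ≠ 0`, THEN every rational `(2,2)`-class lies in `Alg²`.

What is PROVED here (no `sorry`, no new named fact):

* `linearSystemTorelli_middleDivisorSupportFourfold_pairingSplit_of` — the stub's unfolded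
  statement VERBATIM, conditional on ONE named fact of the tree, Grothendieck's coniveau inclusion
  `Grothendieck1969_supportedClasses_le_hodgeConiveau` (`Nˢ Hᵏ` has Hodge coniveau `≥ s`; here only
  its instance `N² H⁴ ⊆ H^{2,2}` on the fourfold is used: algebraic classes are Hodge classes).
* `linearSystemTorelli_middleDivisorSupportFourfold_pairingSplit_of_deligne` — the same,
  conditional instead on Deligne's Hodge III Cor. 8.2.8
  (`Deligne1974_ker_restrictCompl_eq_iSup_range_complexGysin`), through the tree's reduction
  `Grothendieck1969_supportedClasses_le_hodgeConiveau_of_deligne` fed with the THEOREMS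
  `nonempty_hodgeModel_holds` and `exists_deRhamIsoFamily_holds` (both landed 2026-08-16).

Proof (dimension count over `ℚ`, BFNP loc. cit.). Let `H ⊆ H⁴(X(ℂ); ℂ)` be the rational
`(2,2)`-classes (read in one Hodge model, `hodgePQ_independent_of_hodgeModel_holds`) and
`A = Alg²_ℚ` the rational classes of `Alg²`; `Alg² = span_ℂ A` (`supportedClasses_eq_span_isRationalClass`,
proved) and `A ⊆ H` (the coniveau fact), so `Alg² ⊆ span_ℂ H`. The cup product of rational classes
is rational (`IsRationalClass.cup`) and `H⁸(X(ℂ); ℂ) ≅ ℂ` (`X(ℂ)` is a closed connected `ℂ`-oriented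
`8`-manifold: `nonempty_singularCohomology_top_equiv_holds`, `connectedSpace_complexPoints`,
`ComplexPoints.isOrientableOver`, all proved), whose rational classes therefore lie on one
`ℚ`-line (`linearIndependent_iff_of_isRationalClass`). Choosing `ℂ`-bases `b ⊆ H` of `span_ℂ H` and
`a ⊆ A` of `Alg²`, the matrix `(b_i ∪ a_j)` has entries in that `ℚ`-line; if `|b| > |a|` its rows
satisfy a non-trivial RATIONAL relation `Σ qᵢ (bᵢ ∪ a_j) = 0`, so the rational `(2,2)`-class
`Σ qᵢ bᵢ ≠ 0` (the `bᵢ` are `ℂ`-independent) is cup-orthogonal to `Alg²`, contradicting the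
hypothesis. Hence `dim span_ℂ H ≤ dim Alg²`, `Alg² = span_ℂ H ⊇ H`.

Why the fact is needed: without `Alg² ⊆ H^{2,2}` the hypothesis (partners in `Alg²` for classes of
`H`) does not constrain `H` against `Alg²` at all (`V = ℚ²`, `H = ℚe₁`, `Alg = ℚ(e₁ + e₂)`, dot
product, is an abstract counterexample). Status of the fact (2026-08-16): no `_holds`; reduced in
`SupportedClassesHodgeConiveauProofs` (`…_of_deligne`) to Deligne's Hodge III Cor. 8.2.8
(`Deligne1974_ker_restrictCompl_eq_iSup_range_complexGysin`), the other two inputs of that reduction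
(`nonempty_hodgeModel`, de Rham's theorem `exists_deRhamIsoFamily`) being theorems of the tree now.
BFNP (6.1) itself (`hodgeClasses_cupPairing_nondegenerate`) is NOT used.
-/

noncomputable section

namespace Summit.HodgeConjecture.HodgeConjecture.Theorems

open Literature.AlgebraicGeometry Literature.AlgebraicGeometry.HodgeTheory
open Literature.AlgebraicGeometry.Motives
open Literature.AlgebraicTopology.SingularHomology

/-! ### Linear algebra: the dimension count -/

/-- **The dimension count behind "`(Alg)^⊥ ∩ Hdg = 0 ⟹ Hdg = Alg`"** (abstract form). Let `V, W`
be complex vector spaces, `V` finite-dimensional, `B : V × V → W` bilinear and `e : W ≃ ℂ`. Let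
`H ⊆ V` be closed under rational linear combinations and `A ⊆ V` a subset such that the values
`e (B x y)`, `x ∈ H`, `y ∈ A`, all lie on one `ℚ`-line `ℚ · t`, and such that no non-zero `x ∈ H`
is `B`-orthogonal to `A`. Then `dim span_ℂ H ≤ dim span_ℂ A`: for `ℂ`-bases `b ⊆ H`, `a ⊆ A` of the
two spans with `|b| > |a|`, the rows of the rational matrix `(e (B bᵢ aⱼ) / t)` are `ℚ`-dependent,
and a non-trivial rational relation `Σ qᵢ bᵢ` is a non-zero element of `H` orthogonal to `A`.
[cite: BrosnanFangNiePearlstein2009, §6 (6.1)] -/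
theorem pairingSplit_finrank_span_le {V W : Type*} [AddCommGroup V] [Module ℂ V]
    [FiniteDimensional ℂ V] [AddCommGroup W] [Module ℂ W]
    (B : V →ₗ[ℂ] V →ₗ[ℂ] W) (e : W ≃ₗ[ℂ] ℂ) (t : ℂ)
    {H A : Set V} (h0 : (0 : V) ∈ H) (hadd : ∀ x ∈ H, ∀ y ∈ H, x + y ∈ H)
    (hsmul : ∀ (q : ℚ), ∀ x ∈ H, (q : ℂ) • x ∈ H)
    (hval : ∀ x ∈ H, ∀ y ∈ A, ∃ q : ℚ, e (B x y) = q * t)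
    (hP : ∀ x ∈ H, (∀ y ∈ A, B x y = 0) → x = 0) :
    Module.finrank ℂ (Submodule.span ℂ H) ≤ Module.finrank ℂ (Submodule.span ℂ A) := by
  classical
  obtain ⟨b, hbH, hbspan, hbli⟩ := exists_linearIndependent ℂ H
  obtain ⟨a, haA, haspan, hali⟩ := exists_linearIndependent ℂ A
  have hbfin : b.Finite := hbli.set_finite_of_isNoetherian
  have hafin : a.Finite := hali.set_finite_of_isNoetherian
  letI : Fintype b := hbfin.fintype
  letI : Fintype a := hafin.fintype
  rw [← hbspan, ← haspan, finrank_span_set_eq_card (R := ℂ) hbli,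
    finrank_span_set_eq_card (R := ℂ) hali, Set.toFinset_card, Set.toFinset_card]
  -- rational coordinates of the pairing on `b × a`
  choose κ hκ using fun (x : b) (y : a) ↦ hval x (hbH x.2) y (haA y.2)
  by_contra hlt
  rw [not_le] at hlt
  -- more rows than columns: a non-trivial rational relation among the rows `κ x`
  have hdep : ¬ LinearIndependent ℚ κ := by
    intro hli
    have h := hli.fintype_card_le_finrank
    rw [Module.finrank_fintype_fun_eq_card] at h
    exact absurd hlt (not_lt.2 h)
  obtain ⟨g, hg, x₀, hx₀⟩ := Fintype.not_linearIndependent_iff.1 hdep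
  -- the corresponding rational combination of the vectors of `b` lies in `H` …
  set c : V := ∑ x : b, ((g x : ℚ) : ℂ) • (x : V) with hc
  have hcH : c ∈ H :=
    Finset.sum_induction _ (fun v ↦ v ∈ H) (fun u v hu hv ↦ hadd u hu v hv) h0
      fun x _ ↦ hsmul (g x) x (hbH x.2)
  -- … and is orthogonal to `a`, hence to `A ⊆ span a`
  have hca : ∀ y : a, B c y = 0 := by
    intro y
    apply e.injective
    rw [map_zero]
    have h1 : e (B c y) = ((∑ x, g x * κ x y : ℚ) : ℂ) * t := by
      rw [hc, map_sum, LinearMap.sum_apply, map_sum, Rat.cast_sum, Finset.sum_mul]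
      refine Finset.sum_congr rfl fun x _ ↦ ?_
      rw [LinearMap.map_smul, LinearMap.smul_apply, map_smul, hκ, smul_eq_mul, Rat.cast_mul,
        mul_assoc]
    have h2 : ∑ x, g x * κ x y = 0 := by
      have h3 := congr_fun hg y
      rw [Finset.sum_apply] at h3
      simpa only [Pi.smul_apply, smul_eq_mul, Pi.zero_apply] using h3
    rw [h1, h2, Rat.cast_zero, zero_mul]
  have hcA : ∀ y ∈ A, B c y = 0 := by
    have hker : Submodule.span ℂ a ≤ LinearMap.ker (B c) :=
      Submodule.span_le.2 fun y hy ↦ LinearMap.mem_ker.2 (hca ⟨y, hy⟩)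
    intro y hy
    have hy' : y ∈ Submodule.span ℂ a := by
      rw [haspan]
      exact Submodule.subset_span hy
    exact LinearMap.mem_ker.1 (hker hy')
  -- so it vanishes, and the `ℂ`-independence of `b` forces `g = 0`
  have hc0 : c = 0 := hP c hcH hcA
  have hg0 : ∀ x, ((g x : ℚ) : ℂ) = 0 :=
    Fintype.linearIndependent_iff.1 hbli (fun x ↦ ((g x : ℚ) : ℂ)) (by rw [hc] at hc0; exact hc0)
  exact hx₀ (by exact_mod_cast hg0 x₀)

/-! ### Rational classes of a one-dimensional cohomology group lie on a `ℚ`-line -/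

/-- **Rational classes of a line are rational multiples of one of them.** If `Hᵏ(Y; ℂ) ≅ ℂ`
(e.g. the top cohomology of a closed connected oriented manifold), there is `t ∈ ℂ` such that
`e w ∈ ℚ · t` for every rational class `w`: two rational classes are `ℂ`-dependent in the line,
hence `ℚ`-dependent (`linearIndependent_iff_of_isRationalClass`: `Hᵏ(Y; ℚ) ⊗ ℂ → Hᵏ(Y; ℂ)` is
injective). [cite: HatcherAT2002, §3.1 Thm. 3.2 and p. 198] -/
theorem pairingSplit_exists_ratCast_mul {Y : Type*} [TopologicalSpace Y] {k : ℕ}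
    (e : singularCohomology ℂ ℂ Y k ≃ₗ[ℂ] ℂ) :
    ∃ t : ℂ, ∀ w : singularCohomology ℂ ℂ Y k, IsRationalClass w → ∃ q : ℚ, e w = q * t := by
  classical
  by_cases h : ∃ w₀ : singularCohomology ℂ ℂ Y k, IsRationalClass w₀ ∧ w₀ ≠ 0
  · obtain ⟨w₀, hw₀, hne⟩ := h
    refine ⟨e w₀, fun w hw ↦ ?_⟩
    haveI : Module.Finite ℂ (singularCohomology ℂ ℂ Y k) := Module.Finite.equiv e.symm
    -- two vectors of a line are `ℂ`-dependent …
    have hdep : ¬ LinearIndependent ℂ ![w₀, w] := by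
      intro hli
      have h2 := hli.fintype_card_le_finrank
      rw [e.finrank_eq, Module.finrank_self, Fintype.card_fin] at h2
      omega
    -- … hence, being rational, `ℚ`-dependent
    have hrat : ∀ j, IsRationalClass (![w₀, w] j) := fun j ↦ by
      fin_cases j
      · exact hw₀
      · exact hw
    rw [linearIndependent_iff_of_isRationalClass hrat] at hdep
    push Not at hdep
    obtain ⟨q, hq, hq0⟩ := hdep
    rw [Fin.sum_univ_two] at hq
    simp only [Matrix.cons_val_zero, Matrix.cons_val_one] at hq
    have hq1 : q 1 ≠ 0 := by
      intro h1
      rw [h1, Rat.cast_zero, zero_smul, add_zero, smul_eq_zero] at hq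
      rcases hq with h0 | h0
      · apply hq0
        funext j
        fin_cases j
        · simpa using h0
        · simpa using h1
      · exact hne h0
    have h1' : ((q 1 : ℚ) : ℂ) ≠ 0 := by exact_mod_cast hq1
    have h3 : ((q 1 : ℚ) : ℂ) • w = -(((q 0 : ℚ) : ℂ) • w₀) := eq_neg_of_add_eq_zero_right hq
    have h4 : ((q 1 : ℚ) : ℂ) * e w = -(((q 0 : ℚ) : ℂ) * e w₀) := by
      have h5 := congrArg e h3
      rwa [map_smul, map_neg, map_smul, smul_eq_mul, smul_eq_mul] at h5
    refine ⟨-(q 0 / q 1), ?_⟩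
    push_cast
    field_simp
    linear_combination h4
  · push Not at h
    exact ⟨0, fun w hw ↦ ⟨0, by rw [h w hw, map_zero, Rat.cast_zero, zero_mul]⟩⟩

/-! ### Topology of `X(ℂ)` for a smooth projective `X` -/

variable {n : ℕ} {X : SchemeOver ℂ}

/-- **`H²ⁿ(X(ℂ); ℂ) ≅ ℂ`** for `X` smooth projective of dimension `n`: `X(ℂ)` is a closed
(`ComplexPoints.compactSpace/t2Space_of_isSmoothProjective`, charts `IsSmoothProjective.chartedSpace`),
connected (`connectedSpace_complexPoints`, SGA1 XII 2.4) and `ℂ`-orientable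
(`ComplexPoints.isOrientableOver`) topological `2n`-manifold, so Hatcher Thm. 3.30 with `p = 2n`
applies (`nonempty_singularCohomology_top_equiv_holds`, proved in the tree).
[cite: HatcherAT2002, §3.3 Thm. 3.30] -/
theorem pairingSplit_nonempty_topEquiv (hX : IsSmoothProjective n X) :
    Nonempty (complexBetti X (2 * n) ≃ₗ[ℂ] ℂ) := by
  letI := hX.chartedSpace
  haveI := ComplexPoints.compactSpace_of_isSmoothProjective hX
  haveI := ComplexPoints.t2Space_of_isSmoothProjective hX
  haveI := connectedSpace_complexPoints hX
  exact nonempty_singularCohomology_top_equiv_holds ℂ (ComplexPoints X) (2 * n)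
    (ComplexPoints.isOrientableOver ℂ hX)

/-! ### The stub, conditional on Grothendieck's coniveau fact -/

/-- **Stub `PairingSplit` of line `Sketch` for the crux `MiddleDivisorSupportFourfold`
(stmt-HodgeConjecture-2409), conditional form** — de Cataldo–Migliorini arXiv:0711.1307 Fact 4.1
(`n = 2`) / Brosnan–Fang–Nie–Pearlstein 2009 §6, after (6.1): on a smooth projective complex
fourfold, if every non-zero rational `(2,2)`-class pairs non-trivially (cup product into
`H⁸(X(ℂ); ℂ)`) with some class of `Alg² = supportedClasses X 4 2`, then every rational
`(2,2)`-class lies in `Alg²`. The body is VERBATIM the skeleton's `PairingSplit`; the hypothesis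
`hG` is the tree's named fact `Grothendieck1969_supportedClasses_le_hodgeConiveau` (used only as
`N² H⁴ ⊆ H^{2,2}`: rational algebraic classes are `(2,2)`-classes). Proof: `Alg²` is the complex
span of its rational classes (`supportedClasses_eq_span_isRationalClass`), which are rational
`(2,2)`-classes by `hG`; the dimension count `pairingSplit_finrank_span_le` (values of the pairing
in the line `H⁸(X(ℂ); ℂ)`, `pairingSplit_nonempty_topEquiv`, rational on rational classes,
`IsRationalClass.cup`, hence on one `ℚ`-line, `pairingSplit_exists_ratCast_mul`) gives
`dim span_ℂ Hdg ≤ dim Alg²`, so `Alg² = span_ℂ Hdg ∋ c`.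
[cite: BrosnanFangNiePearlstein2009, §6 (6.1)] [cite: GrothendieckTopology1969, p. 299 (∗) and p. 300] -/
theorem linearSystemTorelli_middleDivisorSupportFourfold_pairingSplit_of
    (hG : Grothendieck1969_supportedClasses_le_hodgeConiveau) :
    ∀ ⦃X : Literature.AlgebraicGeometry.Motives.SchemeOver ℂ⦄,
      Literature.AlgebraicGeometry.Motives.IsSmoothProjective 4 X →
      (∀ c : Literature.AlgebraicGeometry.HodgeTheory.complexBetti X 4,
          Literature.AlgebraicGeometry.HodgeTheory.IsRationalClass c →
          Literature.AlgebraicGeometry.HodgeTheory.IsOfHodgeType 4 X 4 2 2 c → c ≠ 0 →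
          ∃ a ∈ Literature.AlgebraicGeometry.HodgeTheory.supportedClasses X 4 2,
            Literature.AlgebraicTopology.SingularHomology.cupProduct (rfl : (4:ℕ) + 4 = 4 + 4) c a ≠ 0) →
      ∀ c : Literature.AlgebraicGeometry.HodgeTheory.complexBetti X 4,
        Literature.AlgebraicGeometry.HodgeTheory.IsRationalClass c →
        Literature.AlgebraicGeometry.HodgeTheory.IsOfHodgeType 4 X 4 2 2 c →
        c ∈ Literature.AlgebraicGeometry.HodgeTheory.supportedClasses X 4 2 := by
  intro X hX hP c₀ hc₀ hH₀
  obtain ⟨A, hA₀⟩ := hH₀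
  -- the `(2,2)`-classes, read in the Hodge model `A` (legitimate: independence of the model)
  let T : Submodule ℂ (complexBetti X 4) := (A.hodgePQ 4 2 2).comap (A.pullback 4).hom
  have hT : ∀ c : complexBetti X 4, IsOfHodgeType 4 X 4 2 2 c ↔ c ∈ T := fun c ↦
    hodgePQ_independent_of_hodgeModel_holds.isOfHodgeType_iff hX A
  -- `Alg² ⊆ H^{2,2}`: the coniveau fact in degree `4`, codimension `2`
  have hST : supportedClasses X 4 2 ≤ T := by
    intro a ha
    have h1 : A.pullback 4 a ∈ A.hodgeConiveau 4 2 := hG hX A 4 2 ⟨a, ha, rfl⟩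
    have hle : A.hodgeConiveau 4 2 ≤ A.hodgePQ 4 2 2 := by
      refine iSup_le fun p ↦ iSup_le fun q ↦ iSup_le fun hpq ↦ iSup_le fun hp ↦
        iSup_le fun hq ↦ ?_
      obtain ⟨rfl, rfl⟩ : p = 2 ∧ q = 2 := ⟨by omega, by omega⟩
      exact le_rfl
    exact hle h1
  -- the rational `(2,2)`-classes `H` and the rational algebraic classes `Aset`
  let H : Set (complexBetti X 4) := {c | IsRationalClass c ∧ c ∈ T}
  let Aset : Set (complexBetti X 4) := {c | IsRationalClass c ∧ c ∈ supportedClasses X 4 2}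
  have hSA : supportedClasses X 4 2 = Submodule.span ℂ Aset :=
    supportedClasses_eq_span_isRationalClass hX 4 2
  have hAH : Aset ⊆ H := fun a ha ↦ ⟨ha.1, hST ha.2⟩
  have hSH : supportedClasses X 4 2 ≤ Submodule.span ℂ H := by
    rw [hSA]
    exact Submodule.span_mono hAH
  -- topology of `X(ℂ)`: `H⁴` is finite-dimensional (`finite_complexBetti`) and `H⁸` is a line
  haveI : FiniteDimensional ℂ (complexBetti X 4) := finite_complexBetti hX 4
  obtain ⟨e₀⟩ := pairingSplit_nonempty_topEquiv hX
  have e : complexBetti X (4 + 4) ≃ₗ[ℂ] ℂ := e₀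
  obtain ⟨t, ht⟩ := pairingSplit_exists_ratCast_mul e
  -- the dimension count
  have hrank : Module.finrank ℂ (Submodule.span ℂ H) ≤
      Module.finrank ℂ (Submodule.span ℂ Aset) := by
    refine pairingSplit_finrank_span_le (cupProduct (rfl : (4:ℕ) + 4 = 4 + 4)) e t
      ⟨IsRationalClass.zero, Submodule.zero_mem _⟩
      (fun x hx y hy ↦ ⟨hx.1.add hy.1, Submodule.add_mem _ hx.2 hy.2⟩)
      (fun q x hx ↦ ⟨hx.1.smul q, Submodule.smul_mem _ _ hx.2⟩)
      (fun x hx y hy ↦ ht _ (hx.1.cup rfl hy.1)) ?_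
    intro x hx hx0
    by_contra hne
    obtain ⟨a, ha, hxa⟩ := hP x hx.1 ((hT x).2 hx.2) hne
    -- `x ∪ ·` vanishes on `Aset`, hence on its span `Alg²`
    have hker : supportedClasses X 4 2 ≤ LinearMap.ker (cupProduct (rfl : (4:ℕ) + 4 = 4 + 4) x) := by
      rw [hSA]
      exact Submodule.span_le.2 fun y hy ↦ LinearMap.mem_ker.2 (hx0 y hy)
    exact hxa (LinearMap.mem_ker.1 (hker ha))
  -- conclusion: `Alg² = span_ℂ H ∋ c₀`
  have hEq : supportedClasses X 4 2 = Submodule.span ℂ H := by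
    refine Submodule.eq_of_le_of_finrank_le hSH ?_
    rw [hSA]
    exact hrank
  rw [hEq]
  exact Submodule.subset_span ⟨hc₀, hA₀⟩

/-- **The same stub, conditional on Deligne's Hodge III Cor. 8.2.8 instead** (the residual trust
base of the coniveau fact): `Grothendieck1969_supportedClasses_le_hodgeConiveau` follows from
`Deligne1974_ker_restrictCompl_eq_iSup_range_complexGysin` (`ker (Hᵇ(X) → Hᵇ(X ∖ ⋃ gⱼ(Yⱼ))) =
Σⱼ im (gⱼ)_*`), the existence of Hodge models (`nonempty_hodgeModel_holds`, a theorem) and de Rham's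
theorem in multiplicative form (`exists_deRhamIsoFamily_holds`, a theorem), by the tree's
`Grothendieck1969_supportedClasses_le_hodgeConiveau_of_deligne` (Grothendieck 1969 p. 300: Gysin
images of desingularisations are sub-Hodge structures of the right coniveau).
[cite: DeligneHodgeIII1974, Cor. 8.2.8] [cite: GrothendieckTopology1969, p. 300] -/
theorem linearSystemTorelli_middleDivisorSupportFourfold_pairingSplit_of_deligne
    (hD : Deligne1974_ker_restrictCompl_eq_iSup_range_complexGysin) :
    ∀ ⦃X : Literature.AlgebraicGeometry.Motives.SchemeOver ℂ⦄,
      Literature.AlgebraicGeometry.Motives.IsSmoothProjective 4 X →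
      (∀ c : Literature.AlgebraicGeometry.HodgeTheory.complexBetti X 4,
          Literature.AlgebraicGeometry.HodgeTheory.IsRationalClass c →
          Literature.AlgebraicGeometry.HodgeTheory.IsOfHodgeType 4 X 4 2 2 c → c ≠ 0 →
          ∃ a ∈ Literature.AlgebraicGeometry.HodgeTheory.supportedClasses X 4 2,
            Literature.AlgebraicTopology.SingularHomology.cupProduct (rfl : (4:ℕ) + 4 = 4 + 4) c a ≠ 0) →
      ∀ c : Literature.AlgebraicGeometry.HodgeTheory.complexBetti X 4,
        Literature.AlgebraicGeometry.HodgeTheory.IsRationalClass c →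
        Literature.AlgebraicGeometry.HodgeTheory.IsOfHodgeType 4 X 4 2 2 c →
        c ∈ Literature.AlgebraicGeometry.HodgeTheory.supportedClasses X 4 2 :=
  linearSystemTorelli_middleDivisorSupportFourfold_pairingSplit_of
    (Grothendieck1969_supportedClasses_le_hodgeConiveau_of_deligne hD
      (fun _ _ ↦ nonempty_hodgeModel_holds)
      fun E _ _ _ ↦ Literature.NumberTheory.Transcendental.exists_deRhamIsoFamily_holds E)

end Summit.HodgeConjecture.HodgeConjecture.Theorems

end
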